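import Summits.QuantumFields.YangMills.Theorems.BalabanUVNodesN07EmlCentredProduct
import Summits.QuantumFields.YangMills.Theorems.BalabanUVNodesN07SymContourData
import Summits.QuantumFields.YangMills.Theorems.UnitScaleTiltProp8ChartDoubleBarDefs
import Literature.MathematicalPhysics.QuantumFieldTheory.Balaban1983to89.Node00.ShearedAveragingRecord
import Literature.MathematicalPhysics.QuantumFieldTheory.Balaban1983to89.BlockAveragingEMLProp2
import HarnessLib

/-!
# N07 [B11] — (G3) of the (L1″) bridge: ONE FRAME STEP ON THE LATTICE — UST's double-bar frame step `V(ȳ)·vframeU((Y♮)^{V⁻¹})(y)` ([3] (110) over `Idx P`)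
# against print's (85) sheared step `S(ȳ)·𝓔_y{S(ȳ)⁻¹·𝐔(y,x)·S(x)}` at the (0.11) AVERAGED contour datum (`symContourData federbushSU`, block operation
# `loopAvgBlockOp expMeanLogSU`): equal up to `φ + O((t+φ)²) + O(p·(p+t+φ)²…)`, coefficient ONE on the incoming frame discrepancy `φ`

Cell `pub-ymgap`, seat `pub-ymgap-dag-n07-e` g28 (LANE OWNER of the K0 road chart side), work file for ⚑ LOCATED-NRM-ROW-CURRENCY option ρ3 (desk memo `WORD-NRM-ROW-CURRENCY.md` §§5–7).
`--kind proof --supports stmt-QuantumFields-20541 --as helper`; count-neutral; 0 sorry.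

WHY.  The induction step of (L1″) («UST accumulated frame `V_l` = print's (97) factor `S_l` up to third order»): with the level-`i` discrepancy `‖V_i(z) − S_i(z)‖ ≤ φ` on the block of
`y`, Federbush's (0.10) centring of the relative stair family (`BlockAveragingFederbush.sum_mlog_mul_star_fedM`) puts the UST family `V(ȳ)⁻¹·Y(Γ^σ_{y,x_r})·V(x_r)` in the form
`c·P̂_{rσ}·Y_r·b_r` of `N07EmlCentredProduct.norm_frameStep_sub_eml_le` (G3a), and print's block operation is `eml` on the small sheared family (`EMLProp2.coe_avg_eq_eml`).
WHAT IS PROVED: ★★★ `norm_frameStep_sub_shearStep_le` (statement below).  HONEST SCOPE: one algebraic∕analytic step about the formal objects; the per-level letters `p, t` and the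
incoming `φ` are HYPOTHESES; nothing of [15]∕[6] is proved; K0⁷ NOT closed; N07 NOT discharged; counts unmoved; nothing continuum ∕ OS ∕ Clay.  No `def`, no `instance`, no `sorry`.

References: [Balaban1985Averaging] (78) p. 30, (85) p. 31, (97)–(100) p. 32, (110) p. 34; [Balaban1987RG1] (0.4)–(0.11) p. 253.
-/

set_option autoImplicit false

noncomputable section

open scoped BigOperators Matrix.Norms.L2Operator
open NormedSpace

namespace Summit.QuantumFields.YangMills.BalabanUVNodes.N07DbarFrameStepBridge

open Literature.MathematicalPhysics.QuantumFieldTheory.Balaban1983to89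
open Literature.MathematicalPhysics.QuantumFieldTheory.Balaban1983to89.Node00
open T4Continuum (walkEnd stairWord)
open BlockAveraging (off Idx)
open MatrixLog ExpMeanLog FederbushMean
open B10Eq27TorusAxialLog (holT gaugeActT unitsField toUField val_holT_unitsField holT_toUField suIncl)
open Summit.QuantumFields.YangMills.Theorems.Prop8Chart (holT_gaugeActT)
open Summit.QuantumFields.YangMills.Theorems.Prop8ChartDoubleBar (vframeU coe_vframeU)
open Summit.QuantumFields.YangMills.BalabanUVNodes.N07SymContourData (permEnum stairFamily symContourData symContourData_holTo_of_small)
open Summit.QuantumFields.YangMills.BalabanUVNodes.N07EmlCentredProduct (norm_frameStep_sub_eml_le)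
open BlockAveragingEMLLinearised (walkEnd_emb_stairWord_eq_blockSite)
open Literature.MathematicalPhysics.QuantumFieldTheory.Balaban1983to89.BlockAveragingEMLProp2 (coe_avg_eq_eml)

variable {P : Params} {N : ℕ} [NeZero N]

local notation "𝕄" => Matrix (Fin N) (Fin N) ℂ
local notation "SUN" => Matrix.specialUnitaryGroup (Fin N) ℂ

/-- ★★★ **(G3) ONE FRAME STEP ON THE LATTICE.**  Level `i` (`i+1 ≤ m+K`), a level-`i` configuration `Y` (in use: `M^i(U^u)`), UST's level-`i` frames `V` (unitary at the centre `ȳ`) and print's `S`,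
a coarse site `y`.  If `‖V(z) − S(z)‖ ≤ φ` at the centre `ȳ` and at every block site `x_r`, the stair families of `Y` at `y` are Federbush-small with relative deviation `p`
(`‖Y(Γ^σ)·F_r* − 1‖ ≤ p`, `F_r = M({Y(Γ^σ_{y,x_r})}_σ)`), and print's sheared family `S(ȳ)⁻¹·F_r·S(x_r)` is within `t` of `1` (`t < δ_SU`, `p ≤ 1∕24`, `2t+3φ ≤ 1∕24`), then
`‖V(ȳ)·vframeU((Y♮)^{V⁻¹})(y) − S(ȳ)·𝓔_y{S(ȳ)⁻¹·𝐔(y,x)·S(x)}‖ ≤ φ + 64(t+φ)² + (1+φ)·(270000·p·(p+2t+3φ)³ + 4·p²·(2t+3φ))`.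
[cite: Balaban1985Averaging, (85) p.31, (97)–(100) p.32, (110) p.34; Balaban1987RG1, (0.10)–(0.11) p.253] -/
theorem norm_frameStep_sub_shearStep_le {i : ℕ} (hi : i + 1 ≤ P.m + P.K) (Y : GaugeField P i SUN)
    (V : Site P i → (𝕄)ˣ) (S : Site P i → SUN) (y : Site P (i + 1)) {p t φ : ℝ}
    (hVu : ((V (emb y) : (𝕄)ˣ) : 𝕄) ∈ Matrix.unitaryGroup (Fin N) ℂ)
    (hφc : ‖((V (emb y) : (𝕄)ˣ) : 𝕄) - ((S (emb y) : SUN) : 𝕄)‖ ≤ φ)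
    (hφb : ∀ r : Fin P.d → Fin P.L, ‖((V (Site.blockSite y r) : (𝕄)ˣ) : 𝕄) - ((S (Site.blockSite y r) : SUN) : 𝕄)‖ ≤ φ)
    (hfam : ∀ r : Fin P.d → Fin P.L, FamilySmall (federbushSU (n := Fin N)).δ (stairFamily Y y r))
    (hP : ∀ (r : Fin P.d → Fin P.L) (k : Fin ((Nat.factorial P.d - 1) + 1)),
      ‖((stairFamily Y y r k : SUN) : 𝕄) * star (((federbushSU (n := Fin N)).M (stairFamily Y y r) : SUN) : 𝕄) - 1‖ ≤ p)
    (hY : ∀ r : Fin P.d → Fin P.L,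
      ‖((((S (emb y))⁻¹ * (symContourData (federbushSU (n := Fin N))).holTo Y y (Site.blockSite y r) * S (Site.blockSite y r) : SUN)) : 𝕄) - 1‖ ≤ t)
    (htδ : t < deltaSU (Fin N)) (hp : p ≤ 1 / 24) (htφ : 2 * t + 3 * φ ≤ 1 / 24) :
    ‖((V (emb y) * vframeU (gaugeActT (fun z => (V z)⁻¹) (unitsField (toUField Y))) y : (𝕄)ˣ) : 𝕄) -
        ((S (emb y) * loopAvgBlockOp expMeanLogSU i y
            (fun x => (S (emb y))⁻¹ * (symContourData (federbushSU (n := Fin N))).holTo Y y x * S x) : SUN) : 𝕄)‖ ≤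
      φ + 64 * (t + φ) ^ 2 + (1 + φ) * (270000 * p * (p + (2 * t + 3 * φ)) ^ 3 + 4 * p ^ 2 * (2 * t + 3 * φ)) := by
  classical
  -- abbreviations (all in `𝕄`)
  set AS : 𝕄 := ((S (emb y) : SUN) : 𝕄) with hAS
  set AV : 𝕄 := ((V (emb y) : (𝕄)ˣ) : 𝕄) with hAV
  have hASu : AS ∈ Matrix.unitaryGroup (Fin N) ℂ := Matrix.specialUnitaryGroup_le_unitaryGroup (S (emb y)).2
  have hAVu : AV ∈ Matrix.unitaryGroup (Fin N) ℂ := hVu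
  have hAS1 : AS * star AS = 1 := Unitary.mul_star_self_of_mem hASu
  have hAS2 : star AS * AS = 1 := Unitary.star_mul_self_of_mem hASu
  have hAVinv : (((V (emb y))⁻¹ : (𝕄)ˣ) : 𝕄) = star AV := Units.inv_eq_of_mul_eq_one_left (Unitary.star_mul_self_of_mem hAVu)
  set a : 𝕄 := star AS * AV with ha_def
  set c : 𝕄 := star AV * AS with hc_def
  have hca : c * a = 1 := by
    rw [hc_def, ha_def, show star AV * AS * (star AS * AV) = star AV * (AS * star AS) * AV by noncomm_ring, hAS1, mul_one, Unitary.star_mul_self_of_mem hAVu]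
  have hac : a * c = 1 := by
    rw [hc_def, ha_def, show star AS * AV * (star AV * AS) = star AS * (AV * star AV) * AS by noncomm_ring, Unitary.mul_star_self_of_mem hAVu, mul_one, hAS2]
  -- norms of the frame errors
  have ha : ‖a - 1‖ ≤ φ := by
    have : a - 1 = star AS * (AV - AS) := by rw [ha_def, mul_sub, hAS2]
    rw [this, CStarRing.norm_mem_unitary_mul _ (Unitary.star_mem hASu)]; exact hφc
  have hc : ‖c - 1‖ ≤ φ := by
    have : c - 1 = star AV * (AS - AV) := by rw [hc_def, mul_sub, Unitary.star_mul_self_of_mem hAVu]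
    rw [this, CStarRing.norm_mem_unitary_mul _ (Unitary.star_mem hAVu), norm_sub_rev]; exact hφc
  set b : (Fin P.d → Fin P.L) → 𝕄 := fun r => star ((S (Site.blockSite y r) : SUN) : 𝕄) * ((V (Site.blockSite y r) : (𝕄)ˣ) : 𝕄) with hb_def
  have hb : ∀ r, ‖b r - 1‖ ≤ φ := by
    intro r
    have hSu : ((S (Site.blockSite y r) : SUN) : 𝕄) ∈ Matrix.unitaryGroup (Fin N) ℂ := Matrix.specialUnitaryGroup_le_unitaryGroup (S _).2
    have : b r - 1 = star ((S (Site.blockSite y r) : SUN) : 𝕄) * (((V (Site.blockSite y r) : (𝕄)ˣ) : 𝕄) - ((S (Site.blockSite y r) : SUN) : 𝕄)) := by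
      rw [hb_def, mul_sub, Unitary.star_mul_self_of_mem hSu]
    rw [this, CStarRing.norm_mem_unitary_mul _ (Unitary.star_mem hSu)]; exact hφb r
  -- the Federbush means and the relative stair family
  set F : (Fin P.d → Fin P.L) → 𝕄 := fun r => (((federbushSU (n := Fin N)).M (stairFamily Y y r) : SUN) : 𝕄) with hF_def
  set Yr : (Fin P.d → Fin P.L) → 𝕄 := fun r => star AS * F r * ((S (Site.blockSite y r) : SUN) : 𝕄) with hYr_def
  set W : (Fin P.d → Fin P.L) → Equiv.Perm (Fin P.d) → 𝕄 := fun r σ => ((holT Y (emb y) (stairWord σ (off r)) : SUN) : 𝕄) with hW_def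
  set Ph : (Fin P.d → Fin P.L) → (Equiv.Perm (Fin P.d) × Equiv.Perm (Fin P.d)) → 𝕄 := fun r s => star AS * (W r s.1 * star (F r)) * AS with hPh_def
  have hYr : ∀ r, ‖Yr r - 1‖ ≤ t := by
    intro r
    have hhol : (symContourData (federbushSU (n := Fin N))).holTo Y y (Site.blockSite y r) = (federbushSU (n := Fin N)).M (stairFamily Y y r) :=
      symContourData_holTo_of_small _ hi Y y r (hfam r)
    have h := hY r
    rw [hhol] at h
    exact h
  -- unitarity bookkeeping for `F r`, `S x_r`
  have hFu : ∀ r, F r ∈ Matrix.unitaryGroup (Fin N) ℂ := fun r => Matrix.specialUnitaryGroup_le_unitaryGroup (SetLike.coe_mem _)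
  have hSu : ∀ r, ((S (Site.blockSite y r) : SUN) : 𝕄) ∈ Matrix.unitaryGroup (Fin N) ℂ := fun r => Matrix.specialUnitaryGroup_le_unitaryGroup (S _).2
  -- (i) the relative stair family is small …
  have hPh : ∀ r s, ‖Ph r s - 1‖ ≤ p := by
    intro r s
    have h1 : Ph r s - 1 = star AS * (W r s.1 * star (F r) - 1) * AS := by
      rw [hPh_def]; simp only; rw [mul_sub, sub_mul, mul_one, hAS2]
    rw [h1, CStarRing.norm_mul_mem_unitary _ hASu, CStarRing.norm_mem_unitary_mul _ (Unitary.star_mem hASu)]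
    have h2 := hP r ((permEnum P).symm s.1)
    have h3 : ((stairFamily Y y r ((permEnum P).symm s.1) : SUN) : 𝕄) = W r s.1 := by
      simp only [hW_def, stairFamily, Equiv.apply_symm_apply]
    rwa [h3] at h2
  -- (ii) … and exactly log-centred (Federbush (0.10))
  have h0 : ∀ r, ∑ s : Equiv.Perm (Fin P.d) × Equiv.Perm (Fin P.d), mlog (Ph r s) = 0 := by
    intro r
    have hsmall : ∀ i k : Fin ((Nat.factorial P.d - 1) + 1),
        ‖((stairFamily Y y r i : SUN) : 𝕄) * star ((stairFamily Y y r k : SUN) : 𝕄) - 1‖ < deltaFed (Fin N) :=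
      (familySmall_SU_iff _).1 (hfam r)
    have hfed : ∑ k : Fin ((Nat.factorial P.d - 1) + 1), mlog (((stairFamily Y y r k : SUN) : 𝕄) * star (F r)) = 0 := by
      have h := sum_mlog_mul_star_fedM (U := fun k => ((stairFamily Y y r k : SUN) : 𝕄)) deltaFed_le hsmall
      have hFr : F r = fedM (deltaFed (Fin N)) (fun k => ((stairFamily Y y r k : SUN) : 𝕄)) := rfl
      rw [hFr]
      exact h
    have hperm : ∑ σ : Equiv.Perm (Fin P.d), mlog (W r σ * star (F r)) = 0 := by
      rw [← Equiv.sum_comp (permEnum P) (fun σ => mlog (W r σ * star (F r)))]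
      simpa only [hW_def, stairFamily] using hfed
    have hconj : ∀ σ : Equiv.Perm (Fin P.d), mlog (star AS * (W r σ * star (F r)) * AS) = star AS * mlog (W r σ * star (F r)) * AS :=
      fun σ => mlog_conj hAS2 hAS1 _
    calc ∑ s : Equiv.Perm (Fin P.d) × Equiv.Perm (Fin P.d), mlog (Ph r s)
        = ∑ σ : Equiv.Perm (Fin P.d), ∑ _σ' : Equiv.Perm (Fin P.d), star AS * mlog (W r σ * star (F r)) * AS := by
          rw [Fintype.sum_prod_type]; simp only [hPh_def, hconj]
      _ = 0 := by
          simp only [Finset.sum_const, Finset.card_univ, ← Finset.smul_sum, ← Finset.mul_sum, ← Finset.sum_mul, hperm, mul_zero, zero_mul, smul_zero]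
  -- (iii) UST's side: `V(ȳ)·vframeU((Y♮)^{V⁻¹})(y) = AV · eml{c·P̂·Y_r·b_r}`
  have hF1 : ∀ r, star (F r) * F r = 1 := fun r => Unitary.star_mul_self_of_mem (hFu r)
  have hS1 : ∀ r, ((S (Site.blockSite y r) : SUN) : 𝕄) * star ((S (Site.blockSite y r) : SUN) : 𝕄) = 1 := fun r => Unitary.mul_star_self_of_mem (hSu r)
  have hmem : ∀ idx : Idx P,
      ((holT (gaugeActT (fun z => (V z)⁻¹) (unitsField (toUField Y))) (emb y) (stairWord idx.2.1 (off idx.1)) : (𝕄)ˣ) : 𝕄) =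
        c * (Ph idx.1 idx.2 * (Yr idx.1 * b idx.1)) := by
    intro idx
    rw [holT_gaugeActT, walkEnd_emb_stairWord_eq_blockSite, inv_inv, Units.val_mul, Units.val_mul, hAVinv, val_holT_unitsField, holT_toUField]
    have hcoe : ((suIncl (holT Y (emb y) (stairWord idx.2.1 (off idx.1))) : Matrix.unitaryGroup (Fin N) ℂ) : 𝕄) = W idx.1 idx.2.1 := rfl
    rw [hcoe]
    have u1 : ∀ X : 𝕄, AS * (star AS * X) = X := fun X => by rw [← mul_assoc, hAS1, one_mul]
    have f1 : ∀ X : 𝕄, star (F idx.1) * (F idx.1 * X) = X := fun X => by rw [← mul_assoc, hF1, one_mul]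
    have s1 : ∀ X : 𝕄, ((S (Site.blockSite y idx.1) : SUN) : 𝕄) * (star ((S (Site.blockSite y idx.1) : SUN) : 𝕄) * X) = X :=
      fun X => by rw [← mul_assoc, hS1, one_mul]
    simp only [hc_def, hPh_def, hYr_def, hb_def, mul_assoc, u1, f1, s1]
  have hUST : ((V (emb y) * vframeU (gaugeActT (fun z => (V z)⁻¹) (unitsField (toUField Y))) y : (𝕄)ˣ) : 𝕄) =
      AV * eml (fun rs : (Fin P.d → Fin P.L) × (Equiv.Perm (Fin P.d) × Equiv.Perm (Fin P.d)) => c * (Ph rs.1 rs.2 * (Yr rs.1 * b rs.1))) := by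
    rw [Units.val_mul, coe_vframeU]
    congr 1
    congr 1
    funext idx
    exact hmem idx
  -- (iv) print's side: `S(ȳ)·𝓔_y{…} = AS · eml{Y_r}`
  have hPR : ((S (emb y) * loopAvgBlockOp expMeanLogSU i y
      (fun x => (S (emb y))⁻¹ * (symContourData (federbushSU (n := Fin N))).holTo Y y x * S x) : SUN) : 𝕄) = AS * eml Yr := by
    rw [Submonoid.coe_mul, loopAvgBlockOp_eq _ hi]
    have hfam_eq : (fun r : Fin P.d → Fin P.L => (S (emb y))⁻¹ * (symContourData (federbushSU (n := Fin N))).holTo Y y (Site.blockSite y r) * S (Site.blockSite y r)) =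
        fun r => (S (emb y))⁻¹ * (federbushSU (n := Fin N)).M (stairFamily Y y r) * S (Site.blockSite y r) := by
      funext r; rw [symContourData_holTo_of_small _ hi Y y r (hfam r)]
    rw [hfam_eq]
    have hsmall : ∀ r : Fin P.d → Fin P.L, dist1 ((S (emb y))⁻¹ * (federbushSU (n := Fin N)).M (stairFamily Y y r) * S (Site.blockSite y r)) < deltaSU (Fin N) := by
      intro r
      have h := hY r
      rw [symContourData_holTo_of_small _ hi Y y r (hfam r)] at h
      exact lt_of_le_of_lt h htδ
    rw [coe_avg_eq_eml _ hsmall]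
    congr 1
  -- (v) assemble: `AV·eml − AS·eml = AS·(a·eml − eml)`, `‖AS·X‖ = ‖X‖`, then (G3a)
  rw [hUST, hPR]
  have hAVa : AV = AS * a := by rw [ha_def, ← mul_assoc, hAS1, one_mul]
  rw [hAVa, mul_assoc, ← mul_sub, CStarRing.norm_mem_unitary_mul _ hASu]
  exact norm_frameStep_sub_eml_le hca hac hPh h0 hYr hb ha hc hp htφ

end Summit.QuantumFields.YangMills.BalabanUVNodes.N07DbarFrameStepBridge

end
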